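import Mathlib
import Summits.PneNP.PneNP.Theorems.OverlapGapAlgebraSolvableImpliesStableSectionUnitClausePairStep

/-!
# PneNP / OverlapGapAlgebra — crux `SolvableImpliesStableSection` (stmt-PneNP-2463):
# the UNIT CLAUSE block (10/·) — summed pair bounds (uncoupled and coupled)

Support for crux `stmt-PneNP-2463` (`Summit.PneNP.PneNP.Theses.OverlapGapAlgebra.SolvableImpliesStableSection`),
registered stub `stub_lowDensity` (child G).  For distinct non-muted clauses `i, i'` and the dynamics in
which both are muted (`S₂ = insert i' (insert i S)`):
* UNCOUPLED: `#C²·Σ_Φ 1[i, i' both unit at t+1] ≤ Σ_Φ cnt_Φ²`, `cnt_Φ = (k²-k)·2U·New·Set^{k-2}` the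
  frozen unit-like count (second moment of the number of unit clauses);
* COUPLED: `#C²·Σ_Φ 1[i, i' unit at t+1 on the SAME variable] ≤ Σ_Φ cnt_Φ · k(k²-k)·2·New·Set^{k-2}` — the
  shared variable costs a factor `1/n` (contradiction pairs, kind (A) of the violated clauses).

* `sissU_sum_pair_indicator_le`, `sissU_sum_cpair_indicator_le`.
All objects are hypotheses; no definitions; axioms `propext`, `Classical.choice`, `Quot.sound`.
-/

set_option linter.dupNamespace false -- `Summit.PneNP.PneNP.…`: summit = sub-problem (D-0017)

namespace Summit.PneNP.PneNP.Theorems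

open Finset
open scoped Classical

section PairSums

variable {m k n : ℕ} {R : ℕ}

/-- **Uncoupled pair bound.** For distinct `i, i' ∉ S`:
`#C·(#C·Σ_Φ 1[i unit at t+1 ∧ i' unit at t+1]) ≤ Σ_Φ cnt_Φ²` with `cnt_Φ` the frozen unit-like count
against the dynamics muting `i` and `i'`. -/
theorem sissU_sum_pair_indicator_le
    (st : Finset (Fin m) → ℕ → (Fin m → Fin k → Fin n × Bool) → Fin n → Option Bool)
    (dm : Finset (Fin m) → ℕ → (Fin m → Fin k → Fin n × Bool) → Fin n → Bool)
    (h0 : ∀ (S : Finset (Fin m)) (Φ : Fin m → Fin k → Fin n × Bool) (v : Fin n), st S 0 Φ v = none)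
    (hstep : ∀ (S : Finset (Fin m)) (t : ℕ) (Φ : Fin m → Fin k → Fin n × Bool) (v : Fin n),
      st S (t + 1) Φ v =
        if st S t Φ v = none then
          (if ∃ i : Fin m, i ∉ S ∧ ∃ j : Fin k, (Φ i j).1 = v ∧ ∀ j' : Fin k, j' ≠ j →
              st S t Φ (Φ i j').1 ≠ none ∧ st S t Φ (Φ i j').1 ≠ some (Φ i j').2
            then some (dm S t Φ v)
            else if (v : ℕ) * R / n = t then some true else none)
        else st S t Φ v)
    (hdm : ∀ (S : Finset (Fin m)) (t : ℕ) (Φ : Fin m → Fin k → Fin n × Bool) (v : Fin n) (i : Fin m)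
      (j : Fin k), i ∉ S → (Φ i j).1 = v → st S t Φ v = none →
      (∀ j' : Fin k, j' ≠ j → st S t Φ (Φ i j').1 ≠ none ∧ st S t Φ (Φ i j').1 ≠ some (Φ i j').2) →
      (∀ i' : Fin m, i' ∉ S → (∃ j₁ : Fin k, (Φ i' j₁).1 = v ∧ ∀ j' : Fin k, j' ≠ j₁ →
        st S t Φ (Φ i' j').1 ≠ none ∧ st S t Φ (Φ i' j').1 ≠ some (Φ i' j').2) → i ≤ i') →
      dm S t Φ v = (Φ i j).2)
    (S : Finset (Fin m)) (t : ℕ) (i i' : Fin m) (hi : i ∉ S) (hi' : i' ∉ S) (hii' : i ≠ i') :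
    (Fintype.card (Fin k → Fin n × Bool) : ℝ) * ((Fintype.card (Fin k → Fin n × Bool) : ℝ) *
      ∑ Φ : Fin m → Fin k → Fin n × Bool,
        (if (∃ j : Fin k, st S (t + 1) Φ (Φ i j).1 = none ∧ ∀ j' : Fin k, j' ≠ j →
              st S (t + 1) Φ (Φ i j').1 ≠ none ∧ st S (t + 1) Φ (Φ i j').1 ≠ some (Φ i j').2) ∧
            (∃ j : Fin k, st S (t + 1) Φ (Φ i' j).1 = none ∧ ∀ j' : Fin k, j' ≠ j →
              st S (t + 1) Φ (Φ i' j').1 ≠ none ∧ st S (t + 1) Φ (Φ i' j').1 ≠ some (Φ i' j').2)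
          then (1 : ℝ) else 0))
      ≤ ∑ Φ : Fin m → Fin k → Fin n × Bool,
          (((k * k - k) * ((2 * ((univ : Finset (Fin n)).filter fun w =>
              st (insert i' (insert i S)) (t + 1) Φ w = none).card) *
            ((univ : Finset (Fin n)).filter fun w => st (insert i' (insert i S)) t Φ w = none ∧
              st (insert i' (insert i S)) (t + 1) Φ w ≠ none).card *
            ((univ : Finset (Fin n)).filter fun w =>
              st (insert i' (insert i S)) (t + 1) Φ w ≠ none).card ^ (k - 2)) : ℕ) : ℝ) ^ 2 := by
  -- the frozen unit-like predicate and `Q = 1[ul x]·1[ul x']`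
  set ul : (Fin k → Fin n × Bool) → (ℕ → Fin n → Option Bool) → Prop := fun x r =>
    ∃ j : Fin k, r (t + 1) (x j).1 = none ∧ (∀ j'' : Fin k, j'' ≠ j →
      r (t + 1) (x j'').1 ≠ none ∧ r (t + 1) (x j'').1 ≠ some (x j'').2) ∧
      ∃ j' : Fin k, j' ≠ j ∧ r t (x j').1 = none with hul
  set Q : (Fin k → Fin n × Bool) → (Fin k → Fin n × Bool) → (ℕ → Fin n → Option Bool) → ℝ :=
    fun x x' r => (if ul x r then (1 : ℝ) else 0) * (if ul x' r then (1 : ℝ) else 0) with hQ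
  have hrr := sissU_pair_rerandomize st dm h0 hstep hdm S i i' hii' Q
  -- pointwise
  have hpt : ∀ Φ : Fin m → Fin k → Fin n × Bool,
      (if (∃ j : Fin k, st S (t + 1) Φ (Φ i j).1 = none ∧ ∀ j' : Fin k, j' ≠ j →
            st S (t + 1) Φ (Φ i j').1 ≠ none ∧ st S (t + 1) Φ (Φ i j').1 ≠ some (Φ i j').2) ∧
          (∃ j : Fin k, st S (t + 1) Φ (Φ i' j).1 = none ∧ ∀ j' : Fin k, j' ≠ j →
            st S (t + 1) Φ (Φ i' j').1 ≠ none ∧ st S (t + 1) Φ (Φ i' j').1 ≠ some (Φ i' j').2)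
        then (1 : ℝ) else 0)
        ≤ Q (Φ i) (Φ i') (fun t' w => st (insert i' (insert i S)) t' Φ w) := by
    intro Φ
    have hQ01 : 0 ≤ Q (Φ i) (Φ i') (fun t' w => st (insert i' (insert i S)) t' Φ w) := by
      rw [hQ]; dsimp only; split_ifs <;> norm_num
    split_ifs with h
    · obtain ⟨⟨j, hj, hrest⟩, ⟨j₂, hj₂, hrest'⟩⟩ := h
      have hp := sissU_pair_unitlike st dm h0 hstep hdm S t Φ i i' hi hi' hii' (Φ i j).1 (Φ i' j₂).1
        ⟨j, rfl, hj, hrest⟩ ⟨j₂, rfl, hj₂, hrest'⟩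
      have h1 : ul (Φ i) (fun t' w => st (insert i' (insert i S)) t' Φ w) := by
        obtain ⟨ja, -, hja, hresta, jb, hjb, hjbt⟩ := hp.1
        rw [hul]; exact ⟨ja, hja, hresta, jb, hjb, hjbt⟩
      have h2 : ul (Φ i') (fun t' w => st (insert i' (insert i S)) t' Φ w) := by
        obtain ⟨ja, -, hja, hresta, jb, hjb, hjbt⟩ := hp.2
        rw [hul]; exact ⟨ja, hja, hresta, jb, hjb, hjbt⟩
      rw [hQ]; dsimp only
      rw [if_pos h1, if_pos h2, mul_one]
    · exact hQ01
  -- frozen count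
  have hcnt : ∀ Φ : Fin m → Fin k → Fin n × Bool,
      ∑ x' : Fin k → Fin n × Bool, ∑ x : Fin k → Fin n × Bool,
          Q x x' (fun t' w => st (insert i' (insert i S)) t' Φ w)
        ≤ (((k * k - k) * ((2 * ((univ : Finset (Fin n)).filter fun w =>
              st (insert i' (insert i S)) (t + 1) Φ w = none).card) *
            ((univ : Finset (Fin n)).filter fun w => st (insert i' (insert i S)) t Φ w = none ∧
              st (insert i' (insert i S)) (t + 1) Φ w ≠ none).card *
            ((univ : Finset (Fin n)).filter fun w =>
              st (insert i' (insert i S)) (t + 1) Φ w ≠ none).card ^ (k - 2)) : ℕ) : ℝ) ^ 2 := by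
    intro Φ
    have hprod : ∑ x' : Fin k → Fin n × Bool, ∑ x : Fin k → Fin n × Bool,
        Q x x' (fun t' w => st (insert i' (insert i S)) t' Φ w)
          = (∑ x : Fin k → Fin n × Bool,
              (if ul x (fun t' w => st (insert i' (insert i S)) t' Φ w) then (1 : ℝ) else 0)) ^ 2 := by
      rw [hQ]; dsimp only
      rw [sq, sum_mul_sum, sum_comm]
    rw [hprod, sum_boole]
    have hc := sissU_count_unitlike_frozen (k := k) (st (insert i' (insert i S)) (t + 1) Φ)
      (st (insert i' (insert i S)) t Φ)
    have hc' : (((univ : Finset (Fin k → Fin n × Bool)).filter fun x =>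
        ul x (fun t' w => st (insert i' (insert i S)) t' Φ w)).card : ℝ) ≤
        (((k * k - k) * ((2 * ((univ : Finset (Fin n)).filter fun w =>
              st (insert i' (insert i S)) (t + 1) Φ w = none).card) *
            ((univ : Finset (Fin n)).filter fun w => st (insert i' (insert i S)) t Φ w = none ∧
              st (insert i' (insert i S)) (t + 1) Φ w ≠ none).card *
            ((univ : Finset (Fin n)).filter fun w =>
              st (insert i' (insert i S)) (t + 1) Φ w ≠ none).card ^ (k - 2)) : ℕ) : ℝ) := by
      have hc'' : ((univ : Finset (Fin k → Fin n × Bool)).filter fun x =>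
          ul x (fun t' w => st (insert i' (insert i S)) t' Φ w)).card ≤
          (k * k - k) * ((2 * ((univ : Finset (Fin n)).filter fun w =>
              st (insert i' (insert i S)) (t + 1) Φ w = none).card) *
            ((univ : Finset (Fin n)).filter fun w => st (insert i' (insert i S)) t Φ w = none ∧
              st (insert i' (insert i S)) (t + 1) Φ w ≠ none).card *
            ((univ : Finset (Fin n)).filter fun w =>
              st (insert i' (insert i S)) (t + 1) Φ w ≠ none).card ^ (k - 2)) := by
        convert hc using 2
      exact_mod_cast hc''
    exact pow_le_pow_left₀ (Nat.cast_nonneg _) hc' 2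
  calc (Fintype.card (Fin k → Fin n × Bool) : ℝ) * ((Fintype.card (Fin k → Fin n × Bool) : ℝ) *
        ∑ Φ : Fin m → Fin k → Fin n × Bool,
          (if (∃ j : Fin k, st S (t + 1) Φ (Φ i j).1 = none ∧ ∀ j' : Fin k, j' ≠ j →
                st S (t + 1) Φ (Φ i j').1 ≠ none ∧ st S (t + 1) Φ (Φ i j').1 ≠ some (Φ i j').2) ∧
              (∃ j : Fin k, st S (t + 1) Φ (Φ i' j).1 = none ∧ ∀ j' : Fin k, j' ≠ j →
                st S (t + 1) Φ (Φ i' j').1 ≠ none ∧ st S (t + 1) Φ (Φ i' j').1 ≠ some (Φ i' j').2)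
            then (1 : ℝ) else 0))
      ≤ (Fintype.card (Fin k → Fin n × Bool) : ℝ) * ((Fintype.card (Fin k → Fin n × Bool) : ℝ) *
          ∑ Φ : Fin m → Fin k → Fin n × Bool, Q (Φ i) (Φ i') (fun t' w => st (insert i' (insert i S)) t' Φ w)) :=
        mul_le_mul_of_nonneg_left (mul_le_mul_of_nonneg_left (sum_le_sum fun Φ _ => hpt Φ)
          (Nat.cast_nonneg _)) (Nat.cast_nonneg _)
    _ = _ := hrr
    _ ≤ _ := sum_le_sum fun Φ _ => hcnt Φ

/-- **Coupled pair bound (contradiction pairs).** For distinct `i, i' ∉ S`: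
`#C·(#C·Σ_Φ 1[∃ v, i and i' both unit on v at t+1]) ≤ Σ_Φ cnt_Φ · (k·k·((k²-k)·(2·New·Set^{k-2})))`. -/
theorem sissU_sum_cpair_indicator_le
    (st : Finset (Fin m) → ℕ → (Fin m → Fin k → Fin n × Bool) → Fin n → Option Bool)
    (dm : Finset (Fin m) → ℕ → (Fin m → Fin k → Fin n × Bool) → Fin n → Bool)
    (h0 : ∀ (S : Finset (Fin m)) (Φ : Fin m → Fin k → Fin n × Bool) (v : Fin n), st S 0 Φ v = none)
    (hstep : ∀ (S : Finset (Fin m)) (t : ℕ) (Φ : Fin m → Fin k → Fin n × Bool) (v : Fin n),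
      st S (t + 1) Φ v =
        if st S t Φ v = none then
          (if ∃ i : Fin m, i ∉ S ∧ ∃ j : Fin k, (Φ i j).1 = v ∧ ∀ j' : Fin k, j' ≠ j →
              st S t Φ (Φ i j').1 ≠ none ∧ st S t Φ (Φ i j').1 ≠ some (Φ i j').2
            then some (dm S t Φ v)
            else if (v : ℕ) * R / n = t then some true else none)
        else st S t Φ v)
    (hdm : ∀ (S : Finset (Fin m)) (t : ℕ) (Φ : Fin m → Fin k → Fin n × Bool) (v : Fin n) (i : Fin m)
      (j : Fin k), i ∉ S → (Φ i j).1 = v → st S t Φ v = none →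
      (∀ j' : Fin k, j' ≠ j → st S t Φ (Φ i j').1 ≠ none ∧ st S t Φ (Φ i j').1 ≠ some (Φ i j').2) →
      (∀ i' : Fin m, i' ∉ S → (∃ j₁ : Fin k, (Φ i' j₁).1 = v ∧ ∀ j' : Fin k, j' ≠ j₁ →
        st S t Φ (Φ i' j').1 ≠ none ∧ st S t Φ (Φ i' j').1 ≠ some (Φ i' j').2) → i ≤ i') →
      dm S t Φ v = (Φ i j).2)
    (S : Finset (Fin m)) (t : ℕ) (i i' : Fin m) (hi : i ∉ S) (hi' : i' ∉ S) (hii' : i ≠ i') :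
    (Fintype.card (Fin k → Fin n × Bool) : ℝ) * ((Fintype.card (Fin k → Fin n × Bool) : ℝ) *
      ∑ Φ : Fin m → Fin k → Fin n × Bool,
        (if ∃ v : Fin n, (∃ j : Fin k, (Φ i j).1 = v ∧ st S (t + 1) Φ v = none ∧ ∀ j' : Fin k, j' ≠ j →
              st S (t + 1) Φ (Φ i j').1 ≠ none ∧ st S (t + 1) Φ (Φ i j').1 ≠ some (Φ i j').2) ∧
            (∃ j : Fin k, (Φ i' j).1 = v ∧ st S (t + 1) Φ v = none ∧ ∀ j' : Fin k, j' ≠ j →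
              st S (t + 1) Φ (Φ i' j').1 ≠ none ∧ st S (t + 1) Φ (Φ i' j').1 ≠ some (Φ i' j').2)
          then (1 : ℝ) else 0))
      ≤ ∑ Φ : Fin m → Fin k → Fin n × Bool,
          ((((k * k - k) * ((2 * ((univ : Finset (Fin n)).filter fun w =>
              st (insert i' (insert i S)) (t + 1) Φ w = none).card) *
            ((univ : Finset (Fin n)).filter fun w => st (insert i' (insert i S)) t Φ w = none ∧
              st (insert i' (insert i S)) (t + 1) Φ w ≠ none).card *
            ((univ : Finset (Fin n)).filter fun w =>
              st (insert i' (insert i S)) (t + 1) Φ w ≠ none).card ^ (k - 2)) : ℕ) : ℝ) *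
          ((k * (k * ((k * k - k) * (2 * ((univ : Finset (Fin n)).filter fun w =>
              st (insert i' (insert i S)) t Φ w = none ∧ st (insert i' (insert i S)) (t + 1) Φ w ≠ none).card *
            ((univ : Finset (Fin n)).filter fun w =>
              st (insert i' (insert i S)) (t + 1) Φ w ≠ none).card ^ (k - 2)))) : ℕ) : ℝ)) := by
  -- frozen predicates: `ul x` (unit-like) and the coupled pair predicate
  set ul : (Fin k → Fin n × Bool) → (ℕ → Fin n → Option Bool) → Prop := fun x r =>
    ∃ j : Fin k, r (t + 1) (x j).1 = none ∧ (∀ j'' : Fin k, j'' ≠ j →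
      r (t + 1) (x j'').1 ≠ none ∧ r (t + 1) (x j'').1 ≠ some (x j'').2) ∧
      ∃ j' : Fin k, j' ≠ j ∧ r t (x j').1 = none with hul
  set fib : (Fin k → Fin n × Bool) → (Fin k → Fin n × Bool) → (ℕ → Fin n → Option Bool) → Prop :=
    fun x x' r => ∃ j : Fin k, r (t + 1) (x j).1 = none ∧ ∃ j₂ : Fin k, (x' j₂).1 = (x j).1 ∧
      (∀ j'' : Fin k, j'' ≠ j₂ → r (t + 1) (x' j'').1 ≠ none ∧ r (t + 1) (x' j'').1 ≠ some (x' j'').2) ∧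
      ∃ j' : Fin k, j' ≠ j₂ ∧ r t (x' j').1 = none with hfib
  set Q : (Fin k → Fin n × Bool) → (Fin k → Fin n × Bool) → (ℕ → Fin n → Option Bool) → ℝ :=
    fun x x' r => if ul x r ∧ fib x x' r then (1 : ℝ) else 0 with hQ
  have hrr := sissU_pair_rerandomize st dm h0 hstep hdm S i i' hii' Q
  -- pointwise
  have hpt : ∀ Φ : Fin m → Fin k → Fin n × Bool,
      (if ∃ v : Fin n, (∃ j : Fin k, (Φ i j).1 = v ∧ st S (t + 1) Φ v = none ∧ ∀ j' : Fin k, j' ≠ j →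
            st S (t + 1) Φ (Φ i j').1 ≠ none ∧ st S (t + 1) Φ (Φ i j').1 ≠ some (Φ i j').2) ∧
          (∃ j : Fin k, (Φ i' j).1 = v ∧ st S (t + 1) Φ v = none ∧ ∀ j' : Fin k, j' ≠ j →
            st S (t + 1) Φ (Φ i' j').1 ≠ none ∧ st S (t + 1) Φ (Φ i' j').1 ≠ some (Φ i' j').2)
        then (1 : ℝ) else 0)
        ≤ Q (Φ i) (Φ i') (fun t' w => st (insert i' (insert i S)) t' Φ w) := by
    intro Φ
    have hQ01 : 0 ≤ Q (Φ i) (Φ i') (fun t' w => st (insert i' (insert i S)) t' Φ w) := by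
      rw [hQ]; dsimp only; split_ifs <;> norm_num
    split_ifs with h
    · obtain ⟨v, hu, hu'⟩ := h
      have hp := sissU_pair_unitlike st dm h0 hstep hdm S t Φ i i' hi hi' hii' v v hu hu'
      obtain ⟨ja, hjav, hja, hresta, jb, hjb, hjbt⟩ := hp.1
      obtain ⟨jc, hjcv, hjc, hrestc, jd, hjd, hjdt⟩ := hp.2
      have h1 : ul (Φ i) (fun t' w => st (insert i' (insert i S)) t' Φ w) := by
        rw [hul]; exact ⟨ja, hja, hresta, jb, hjb, hjbt⟩
      have h2 : fib (Φ i) (Φ i') (fun t' w => st (insert i' (insert i S)) t' Φ w) := by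
        rw [hfib]
        exact ⟨ja, hja, jc, by rw [hjcv, hjav], hrestc, jd, hjd, hjdt⟩
      rw [hQ]; dsimp only
      rw [if_pos ⟨h1, h2⟩]
    · exact hQ01
  -- frozen count via the fibrewise bound
  have hcnt : ∀ Φ : Fin m → Fin k → Fin n × Bool,
      ∑ x' : Fin k → Fin n × Bool, ∑ x : Fin k → Fin n × Bool,
          Q x x' (fun t' w => st (insert i' (insert i S)) t' Φ w)
        ≤ ((((k * k - k) * ((2 * ((univ : Finset (Fin n)).filter fun w =>
              st (insert i' (insert i S)) (t + 1) Φ w = none).card) *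
            ((univ : Finset (Fin n)).filter fun w => st (insert i' (insert i S)) t Φ w = none ∧
              st (insert i' (insert i S)) (t + 1) Φ w ≠ none).card *
            ((univ : Finset (Fin n)).filter fun w =>
              st (insert i' (insert i S)) (t + 1) Φ w ≠ none).card ^ (k - 2)) : ℕ) : ℝ) *
          ((k * (k * ((k * k - k) * (2 * ((univ : Finset (Fin n)).filter fun w =>
              st (insert i' (insert i S)) t Φ w = none ∧ st (insert i' (insert i S)) (t + 1) Φ w ≠ none).card *
            ((univ : Finset (Fin n)).filter fun w =>
              st (insert i' (insert i S)) (t + 1) Φ w ≠ none).card ^ (k - 2)))) : ℕ) : ℝ)) := by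
    intro Φ
    set r : ℕ → Fin n → Option Bool := fun t' w => st (insert i' (insert i S)) t' Φ w with hr
    -- the double sum is the cardinality of the pair set
    have hpair : ∑ x' : Fin k → Fin n × Bool, ∑ x : Fin k → Fin n × Bool, Q x x' r =
        (((univ : Finset ((Fin k → Fin n × Bool) × (Fin k → Fin n × Bool))).filter fun p =>
          p.1 ∈ (univ : Finset (Fin k → Fin n × Bool)).filter (fun x => ul x r) ∧
          p.2 ∈ (univ : Finset (Fin k → Fin n × Bool)).filter (fun x' => fib p.1 x' r)).card : ℝ) := by
      rw [sum_comm, ← sum_boole]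
      rw [← Fintype.sum_prod_type' fun x x' => Q x x' r]
      refine sum_congr rfl fun p _ => ?_
      rw [hQ]; dsimp only
      simp only [mem_filter, mem_univ, true_and]
    rw [hpair]
    have hfibre : ∀ x ∈ (univ : Finset (Fin k → Fin n × Bool)).filter (fun x => ul x r),
        ((univ : Finset (Fin k → Fin n × Bool)).filter (fun x' => fib x x' r)).card ≤
          k * (k * ((k * k - k) * (2 * ((univ : Finset (Fin n)).filter fun w => r t w = none ∧ r (t + 1) w ≠ none).card *
            ((univ : Finset (Fin n)).filter fun w => r (t + 1) w ≠ none).card ^ (k - 2)))) := by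
      intro x _
      -- union over the slot `j` of `x`
      have hsub : ((univ : Finset (Fin k → Fin n × Bool)).filter fun x' => fib x x' r) ⊆
          (univ : Finset (Fin k)).biUnion fun j => (univ : Finset (Fin k → Fin n × Bool)).filter fun x' =>
            ∃ j₂ : Fin k, (x' j₂).1 = (x j).1 ∧
              (∀ j'' : Fin k, j'' ≠ j₂ → r (t + 1) (x' j'').1 ≠ none ∧ r (t + 1) (x' j'').1 ≠ some (x' j'').2) ∧
              ∃ j' : Fin k, j' ≠ j₂ ∧ r t (x' j').1 = none := by
        intro x' hx'
        rw [mem_filter, hfib] at hx'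
        obtain ⟨-, j, -, hrest⟩ := hx'
        rw [mem_biUnion]
        exact ⟨j, mem_univ _, by rw [mem_filter]; exact ⟨mem_univ _, hrest⟩⟩
      refine (card_le_card hsub).trans (card_biUnion_le.trans ?_)
      refine (sum_le_sum fun j _ => sissU_count_coupled_frozen (k := k) (r (t + 1)) (r t) (x j).1).trans ?_
      rw [sum_const, card_univ, Fintype.card_fin, smul_eq_mul]
    have hP : ((univ : Finset (Fin k → Fin n × Bool)).filter (fun x => ul x r)).card ≤
        (k * k - k) * ((2 * ((univ : Finset (Fin n)).filter fun w => r (t + 1) w = none).card) *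
          ((univ : Finset (Fin n)).filter fun w => r t w = none ∧ r (t + 1) w ≠ none).card *
          ((univ : Finset (Fin n)).filter fun w => r (t + 1) w ≠ none).card ^ (k - 2)) := by
      convert sissU_count_unitlike_frozen (k := k) (r (t + 1)) (r t) using 2
    have hpl : ((univ : Finset ((Fin k → Fin n × Bool) × (Fin k → Fin n × Bool))).filter fun p =>
          p.1 ∈ (univ : Finset (Fin k → Fin n × Bool)).filter (fun x => ul x r) ∧
          p.2 ∈ (univ : Finset (Fin k → Fin n × Bool)).filter (fun x' => fib p.1 x' r)).card ≤
        ((univ : Finset (Fin k → Fin n × Bool)).filter (fun x => ul x r)).card *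
          (k * (k * ((k * k - k) * (2 * ((univ : Finset (Fin n)).filter fun w => r t w = none ∧ r (t + 1) w ≠ none).card *
            ((univ : Finset (Fin n)).filter fun w => r (t + 1) w ≠ none).card ^ (k - 2))))) := by
      convert sissU_card_pairs_le _ _ _ hfibre using 4
    calc ((((univ : Finset ((Fin k → Fin n × Bool) × (Fin k → Fin n × Bool))).filter fun p =>
          p.1 ∈ (univ : Finset (Fin k → Fin n × Bool)).filter (fun x => ul x r) ∧
          p.2 ∈ (univ : Finset (Fin k → Fin n × Bool)).filter (fun x' => fib p.1 x' r)).card : ℕ) : ℝ)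
        ≤ ((((univ : Finset (Fin k → Fin n × Bool)).filter (fun x => ul x r)).card *
            (k * (k * ((k * k - k) * (2 * ((univ : Finset (Fin n)).filter fun w => r t w = none ∧ r (t + 1) w ≠ none).card *
              ((univ : Finset (Fin n)).filter fun w => r (t + 1) w ≠ none).card ^ (k - 2))))) : ℕ) : ℝ) := by
          exact_mod_cast hpl
      _ ≤ _ := by
          rw [hr]
          exact_mod_cast Nat.mul_le_mul_right _ hP
  calc (Fintype.card (Fin k → Fin n × Bool) : ℝ) * ((Fintype.card (Fin k → Fin n × Bool) : ℝ) *
        ∑ Φ : Fin m → Fin k → Fin n × Bool,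
          (if ∃ v : Fin n, (∃ j : Fin k, (Φ i j).1 = v ∧ st S (t + 1) Φ v = none ∧ ∀ j' : Fin k, j' ≠ j →
                st S (t + 1) Φ (Φ i j').1 ≠ none ∧ st S (t + 1) Φ (Φ i j').1 ≠ some (Φ i j').2) ∧
              (∃ j : Fin k, (Φ i' j).1 = v ∧ st S (t + 1) Φ v = none ∧ ∀ j' : Fin k, j' ≠ j →
                st S (t + 1) Φ (Φ i' j').1 ≠ none ∧ st S (t + 1) Φ (Φ i' j').1 ≠ some (Φ i' j').2)
            then (1 : ℝ) else 0))
      ≤ (Fintype.card (Fin k → Fin n × Bool) : ℝ) * ((Fintype.card (Fin k → Fin n × Bool) : ℝ) *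
          ∑ Φ : Fin m → Fin k → Fin n × Bool, Q (Φ i) (Φ i') (fun t' w => st (insert i' (insert i S)) t' Φ w)) :=
        mul_le_mul_of_nonneg_left (mul_le_mul_of_nonneg_left (sum_le_sum fun Φ _ => hpt Φ)
          (Nat.cast_nonneg _)) (Nat.cast_nonneg _)
    _ = _ := hrr
    _ ≤ _ := sum_le_sum fun Φ _ => hcnt Φ

end PairSums

end Summit.PneNP.PneNP.Theorems
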